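import Mathlib
import Summits.Ventures.HodgeRepro0.P2Dim8H1H2Lattice
import Summits.Ventures.HodgeRepro0.P2Dim8H1H2AllCarriers

/-!
# P2Dim8H1H2LatticeC — two precisions of rev-2 (g8)'s PRIMARY reading of P2-H1H2Reduction v1 (STATUS l.2454, P-2 and P-4), by `decide`
(seat p2 (g4), pub-hodge-repro0)

* `group_T6`, `group_T8` (P-2): the lists `T6`, `T8` of `P2Dim8H1H2AllCarriers` (T̄ classes 6 and 8, T classes 2080 and 2012) are closed
  under composition, contain `ι` and have 8 elements — so, like `T3 = P2Dim8H1H2Lattice.T` (`group_T` there), they are groups, not only data.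
* `hg_rank_four_*` (P-4): rank Hg(X) = 4 for the reflex pair `X = A × A*` (blocks 0, 2 of the representative) directly from the difference
  lattice (the precision of record STATUS l.2351): with `d_t := v_t − v_1` (the cocharacter vector of `t` minus that of the identity, on the
  8 points of `X`), (a) `d_{tι} + d_t = d_ι` for every `t ∈ T` — so the ℚ-span of all differences `v_t − v_{t′} = d_t − d_{t′}` is spanned
  by `d_ι` and the `d_t` of three coset representatives: rank ≤ 4; (b) the 4 × 4 minor of the rows `d_{T[1]}, d_{T[2]}, d_{T[3]}, d_{T[4]}`
  on the points `0, 1, 8, 9` has determinant 1: rank ≥ 4. Hence `X_*(Hg(X)) ⊗ ℚ` (= the difference span, Hz85 (1.1) p. 492) has rank 4 =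
  rdim X, for both types `Φ₁` and `Φ₂` — the input of Lemma 4.1 (Hazama (2.7)) is kernel-checked, not script-only.
-/

namespace HodgeRepro0.P2Dim8H1H2LatticeC

open HodgeRepro0.P2Dim8H1H2Lattice HodgeRepro0.P2Dim8H1H2AllCarriers

/-- `T6` is closed under composition, contains `ι` and has 8 elements -/
theorem group_T6 : closed T6 = true ∧ T6.elem iota = true ∧ T6.length = 8 := by decide

/-- `T8` is closed under composition, contains `ι` and has 8 elements -/
theorem group_T8 : closed T8 = true ∧ T8.elem iota = true ∧ T8.length = 8 := by decide

/-- the difference vector `d_t = v_t − v_1` of `t` on a list of points (`v_1` = the cocharacter vector of the identity) -/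
def dvec (Phi t : List Nat) (pts : List Nat) : List Int :=
  pts.map (fun x => cochar Phi t x - cochar Phi (List.range 16) x)

/-- the 4 × 4 matrix of the difference vectors of the elements `T[1], …, T[4]` on the points `0, 1, 8, 9` -/
def diffMinor (Phi : List Nat) : List (List Int) :=
  [1, 2, 3, 4].map (fun i => dvec Phi (T.getD i []) [0, 1, 8, 9])

/-- rank Hg(X) = 4 under `Φ₁`: (a) `d_{tι} + d_t = d_ι` on the 8 points of `X` for every `t` (rank ≤ 4); (b) a 4 × 4 minor of determinant 1 (rank ≥ 4) -/
theorem hg_rank_four_Phi1 :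
    (T.all (fun t => addL (dvec Phi1 (comp t iota) ptsX) (dvec Phi1 t ptsX) == dvec Phi1 iota ptsX)) = true ∧
    det4 (diffMinor Phi1) = 1 := by decide

/-- the same under `Φ₂` -/
theorem hg_rank_four_Phi2 :
    (T.all (fun t => addL (dvec Phi2 (comp t iota) ptsX) (dvec Phi2 t ptsX) == dvec Phi2 iota ptsX)) = true ∧
    det4 (diffMinor Phi2) = 1 := by decide

end HodgeRepro0.P2Dim8H1H2LatticeC
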